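import Mathlib.MeasureTheory.Function.LpSeminorm.Basic
import Mathlib.Analysis.Calculus.ContDiff.Defs
import Literature.Analysis.FluidPDE.SelfSimilar
import Literature.Analysis.FluidPDE.MildSolution
import Literature.Analysis.FluidPDE.SuitableWeak
import HarnessLib

/-!
# Finite-time blow-up generates a nontrivial bounded ancient mild solution (KNSS zoom-in)

Trunk T-FLUID (`Literature/Analysis/FluidPDE`), problem `NavierStokesRegularity`, route
`TypeILiouville`; wanted as hypothesis for `stmt-NavierStokesRegularity-0058`.

The **rescaling (zoom-in) procedure** of Koch–Nadirashvili–Seregin–Šverák (Acta Math. 203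
(2009), §6, (6.1)–(6.3), Lemma 6.1 and Proposition 6.1; going back to Seregin–Šverák 2009 and,
for the compactness of bounded mild solutions, to §4 of KNSS): let `u` be the mild solution of the
Navier–Stokes equations on `ℝ³ × (0, T)` from a bounded datum `u₀ ∈ L^∞`, and suppose `(0, T)` is
its maximal interval of existence (equivalently, by the `L^∞` local theory and Leray's lower
bound (6.1) `h(t) ≥ ε₁ (T - t)^{-1/2}`, `u` is bounded on `ℝ³ × (0, T')` for every `T' < T` but
not on `ℝ³ × (0, T)`). Rescaling `v^{(k)}(y, s) = M_k⁻¹ u(x_k + y/M_k, t_k + s/M_k²)` around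
near-maxima `|u(x_k, t_k)| = M_k → ∞` and passing to a locally uniform limit gives a mild bounded
**ancient** solution `v` on `ℝ³ × (-∞, 0)`, smooth (KNSS §4), with `|v| ≤ 1` and
`|v(0, 0)| = 1`; in particular `v` is not identically zero:

> **Proposition 6.1.** A finite-time singularity arising from a mild solution generates a bounded
> ancient mild solution which is not identically zero.

We vendor this as the named fact `Literature.Analysis.FluidPDE.KNSS2009_blowup_generates_ancient` over the accepted
prelude notions `Fluid.IsMildNSSolutionOn` (duality-form mild solutions from a datum,
`MildSolution.lean`), `Fluid.IsBoundedOn`, `Fluid.IsBoundedAncientMildSolution`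
(`SelfSimilar.lean`); the Type I refinement asked for by the route needs no separate statement
(Proposition 6.1 does not use the Type I bound `Fluid.IsTypeIBlowup`; under it the same `v`
is produced), see `KNSS2009_blowup_generates_ancient.of_isTypeIBlowup`.

## Rendering choices

* "`(0, T)` is the maximal interval of existence of the mild solution with datum `u₀ ∈ L^∞`" is
  rendered by its `L^∞` characterisation: `u` is a mild solution on `[0, T)`, bounded on `[0, T')`
  for every `T' < T`, and **not** bounded on `[0, T)` (KNSS §4 and (6.1)). Measurability of the
  slices is assumed explicitly because the duality-form integrals of `IsMildNSSolutionOn` have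
  junk value `0` on non-measurable data.
* `|v(0, 0)| = 1` presupposes the continuous extension of `v` to `t = 0` provided by the uniform
  local regularity of KNSS §4; we record the *weaker* consequence that needs no value at `t = 0`:
  `|v| ≤ 1` on `(-∞, 0) × ℝ³` and `sup_{t < 0, x} |v(t, x)| = 1` (values above `1 - ε` occur for
  every `ε > 0`), from which non-triviality (`v` is not identically zero on `(-∞, 0) × ℝ³`) is
  proved below (`KNSS2009_blowup_generates_ancient.nontrivial`).
* Viscosity is normalised to `ν = 1` and the force to `0`, as in KNSS.

## References

* G. Koch, N. Nadirashvili, G. Seregin, V. Šverák, *Liouville theorems for the Navier–Stokes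
  equations and applications*, Acta Math. 203 (2009), 83–105 (arXiv:0709.3599): §4 (bounded
  mild solutions are smooth), §6, (6.1)–(6.3), Lemma 6.1, Proposition 6.1.
* G. Seregin, V. Šverák, *On Type I singularities of the local axi-symmetric solutions of the
  Navier–Stokes equations*, Comm. PDE 34 (2009), 171–201, §1.
* G. Seregin, *A certain necessary condition of potential blow up for Navier–Stokes equations*,
  Comm. Math. Phys. 312 (2012), 833–845, §1.
-/

noncomputable section

open MeasureTheory Set Function Filter Topology
open scoped ContDiff NNReal ENNReal

namespace Literature.Analysis.FluidPDE

/-- Local notation for physical space `ℝ³ = EuclideanSpace ℝ (Fin 3)`. -/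
local notation "ℝ³" => EuclideanSpace ℝ (Fin 3)

/-- The conclusion of the KNSS zoom-in: `v` is a **KNSS blow-up limit** — a bounded ancient mild
solution of Navier–Stokes (`ν = 1`) on `(-∞, 0) × ℝ³` with measurable slices, smooth on the open
half-space–time `(-∞, 0) × ℝ³` (KNSS §4), bounded by `1`, and with `sup_{t<0, x} |v(t,x)| = 1`
(the printed `|v(0,0)| = 1` read without evaluating at `t = 0`).
[cite: KNSS2009, §6 (6.3) and Lemma 6.1] -/
structure IsKNSSBlowupLimit (v : ℝ → ℝ³ → ℝ³) : Prop where
  /-- `v` is a bounded ancient mild solution on `(-∞, 0)` (`ν = 1`) -/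
  isBoundedAncientMildSolution : FluidPDE.IsBoundedAncientMildSolution 1 v
  /-- the slices are measurable -/
  aestronglyMeasurable : ∀ t < 0, AEStronglyMeasurable (v t) volume
  /-- `v` is smooth on `(-∞, 0) × ℝ³` (KNSS §4: bounded mild solutions are smooth) -/
  smooth : ContDiffOn ℝ ∞ (uncurry v) (Iio 0 ×ˢ univ)
  /-- `|v| ≤ 1` on `(-∞, 0) × ℝ³` -/
  norm_le_one : ∀ t < 0, ∀ x, ‖v t x‖ ≤ 1
  /-- `sup |v| = 1`: values above `1 - ε` are attained for every `ε > 0` -/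
  exists_lt_norm : ∀ ε : ℝ, 0 < ε → ∃ t < 0, ∃ x, 1 - ε < ‖v t x‖

/-- **KNSS 2009, Proposition 6.1** ("A finite-time singularity arising from a mild solution
generates a bounded ancient mild solution which is not identically zero"), with the quantitative
content of its proof ((6.2)–(6.3), Lemma 6.1). Let `0 < T`, let `u₀ : ℝ³ → ℝ³` be bounded and
measurable, and let `u` be a mild solution of the Navier–Stokes equations (`ν = 1`, `f = 0`) on
`[0, T)` from `u₀` (`Fluid.IsMildNSSolutionOn (Ico 0 T) 1 0 u₀ u`, measurable slices) which is
bounded on `[0, T') × ℝ³` for every `T' < T` but not on `[0, T) × ℝ³` (i.e. `T` is the maximal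
existence time: a finite-time singularity). Then there is a KNSS blow-up limit `v`
(`IsKNSSBlowupLimit`): a smooth bounded ancient mild solution with `|v| ≤ 1 = sup |v|`.
[cite: KNSS2009, Prop. 6.1 and (6.2)–(6.3)] -/
def KNSS2009_blowup_generates_ancient : Prop :=
  ∀ (T : ℝ) (u₀ : ℝ³ → ℝ³) (u : ℝ → ℝ³ → ℝ³), 0 < T →
    AEStronglyMeasurable u₀ volume → (∃ C : ℝ, ∀ x, ‖u₀ x‖ ≤ C) →
    (∀ t ∈ Ico 0 T, AEStronglyMeasurable (u t) volume) →
    FluidPDE.IsMildNSSolutionOn (Ico 0 T) 1 0 u₀ u →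
    (∀ T' < T, FluidPDE.IsBoundedOn (Ico 0 T') u) → ¬ FluidPDE.IsBoundedOn (Ico 0 T) u →
      ∃ v : ℝ → ℝ³ → ℝ³, IsKNSSBlowupLimit v

variable {v : ℝ → ℝ³ → ℝ³}

/-- A KNSS blow-up limit is **not identically zero** on `(-∞, 0) × ℝ³` (Proposition 6.1's
"which is not identically zero"): some value has norm `> 1/2`. [cite: KNSS2009, Prop. 6.1] -/
theorem IsKNSSBlowupLimit.nontrivial (h : IsKNSSBlowupLimit v) : ¬ ∀ t < 0, ∀ x, v t x = 0 := by
  intro h0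
  obtain ⟨t, ht, x, hx⟩ := h.exists_lt_norm (1 / 2) one_half_pos
  rw [h0 t ht x, norm_zero] at hx
  norm_num at hx

/-- The supremum of `|v|` over `(-∞, 0) × ℝ³` is exactly `1`. [cite: KNSS2009, §6 (6.3)] -/
theorem IsKNSSBlowupLimit.iSup_norm_eq_one (h : IsKNSSBlowupLimit v) :
    (⨆ z : {z : ℝ × ℝ³ // z.1 < 0}, ‖v z.1.1 z.1.2‖) = 1 := by
  have hbdd : BddAbove (Set.range fun z : {z : ℝ × ℝ³ // z.1 < 0} => ‖v z.1.1 z.1.2‖) :=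
    ⟨1, by rintro _ ⟨z, rfl⟩; exact h.norm_le_one _ z.2 _⟩
  obtain ⟨t₀, ht₀, x₀, -⟩ := h.exists_lt_norm 1 one_pos
  haveI : Nonempty {z : ℝ × ℝ³ // z.1 < 0} := ⟨⟨(t₀, x₀), ht₀⟩⟩
  refine le_antisymm (ciSup_le fun z => h.norm_le_one _ z.2 _) ?_
  refine le_of_forall_pos_lt_add fun ε hε => ?_
  obtain ⟨t, ht, x, hx⟩ := h.exists_lt_norm ε hε
  have := le_ciSup hbdd ⟨(t, x), ht⟩
  simp only at this
  linarith

/-- A KNSS blow-up limit is a bounded ancient mild solution (projection, for use as the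
hypothesis of the Liouville conjecture `LiouvilleConjectureNS`). [folklore] -/
theorem IsKNSSBlowupLimit.isAncient (h : IsKNSSBlowupLimit v) :
    FluidPDE.IsBoundedAncientMildSolution 1 v :=
  h.isBoundedAncientMildSolution

/-- **Type I specialisation** (the form used on route `TypeILiouville`; Seregin–Šverák 2009, §1;
KNSS 2009, §6): under `KNSS2009_blowup_generates_ancient`, a mild solution from bounded data
that is bounded before `T`, unbounded up to `T` and (redundantly for this conclusion) blows up
at the Type I rate `‖u(t)‖_∞ ≤ C (T - t)^{-1/2}` (`Fluid.IsTypeIBlowup`) generates a KNSS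
blow-up limit. [cite: KNSS2009, Prop. 6.1] -/
theorem KNSS2009_blowup_generates_ancient.of_isTypeIBlowup
    (h : KNSS2009_blowup_generates_ancient) {T : ℝ} {u₀ : ℝ³ → ℝ³} {u : ℝ → ℝ³ → ℝ³}
    (hT : 0 < T) (hu₀m : AEStronglyMeasurable u₀ volume) (hu₀b : ∃ C : ℝ, ∀ x, ‖u₀ x‖ ≤ C)
    (hum : ∀ t ∈ Ico 0 T, AEStronglyMeasurable (u t) volume)
    (hmild : FluidPDE.IsMildNSSolutionOn (Ico 0 T) 1 0 u₀ u)
    (hbdd : ∀ T' < T, FluidPDE.IsBoundedOn (Ico 0 T') u) (hunb : ¬ FluidPDE.IsBoundedOn (Ico 0 T) u)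
    (_hI : FluidPDE.IsTypeIBlowup u T) :
    ∃ v : ℝ → ℝ³ → ℝ³, IsKNSSBlowupLimit v :=
  h T u₀ u hT hu₀m hu₀b hum hmild hbdd hunb

end Literature.Analysis.FluidPDE
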